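import Summits.Parity.GeneralizedHardyLittlewood.Theorems.BeyondDiagonalBeatsQuarter.CornerWeight
import HarnessLib

/-!
# Route `PrimeLevelFamEdge`, crux K_A `MomentsBeyondDiagonal` (stmt-Parity-20007), line «petersson_layers» v4, stub `stub_diag`:
# **pointwise structure of the two-dimensional Bose kernel: `e^{−φ}(1−e^{−φ})^{−2} = 1/φ² + O(1)` (census R2, brick)**

The general Bose coefficients `c_ab(y) = ∫_{u₁>0}(log u₁)^a∫_{u₂>y/u₁} B(u₁+u₂)(log u₂)^b` (`…DiagBoseOuter`, `b ≥ 1`) involve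
the kernel `B(φ) = e^{−φ}(1−e^{−φ})^{−2} = Σ_{t≥1} t e^{−tφ} = (e^φ + e^{−φ} − 2)⁻¹ = (4 sinh²(φ/2))⁻¹`. As for the
one-dimensional kernel (`…DiagBoseB0Kernel`), its small-`φ` structure is a rational main part plus a bounded error:

* `bose_kernel_eq_inv` — `e^{−φ}(1−e^{−φ})^{−2} = (e^φ + e^{−φ} − 2)⁻¹`;
* `bose_kernel_le_inv_sq` — `B(φ) ≤ 1/φ²` for `φ > 0` (`φ² ≤ e^φ + e^{−φ} − 2`, K_B's `Corner.sq_le_exp_add_exp_neg_sub_two`);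
* `exp_add_exp_neg_sub_two_le` — `e^φ + e^{−φ} − 2 ≤ φ² + (5/48)φ⁴` for `0 ≤ φ ≤ 1` (Mathlib's `Real.exp_bound`, order 4);
* `abs_bose_kernel_sub_inv_sq_le` — **`|B(φ) − 1/φ²| ≤ 1` for every `φ > 0`**.

Def-free; theorems only. Helper `--supports stmt-Parity-20007`; closes nothing; K_A, K_B and the Parity summit are NOT
proved; nothing about Landau–Siegel zeros.

## References
* E. Kowalski, P. Michel, J. VanderKam, J. reine angew. Math. 526 (2000), (21)–(22) p. 12 (the cut-off weight of the
  diagonal). [cite: KowalskiMichelVanderKam2000, (21)–(22) — derivation (real form of the Bose kernel)]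
-/

noncomputable section

open Finset

namespace Summit.Parity.GeneralizedHardyLittlewood.Theorems.MomentsBeyondDiagonal.DiagLines

open Summit.Parity.GeneralizedHardyLittlewood.Theorems.BeyondDiagonalBeatsQuarter.Corner (sq_le_exp_add_exp_neg_sub_two)

/-- `e^{−φ}/(1−e^{−φ})² = (e^φ + e^{−φ} − 2)⁻¹` (for every real `φ`; both sides are `0` at `φ = 0`). [folklore] -/
theorem bose_kernel_eq_inv (φ : ℝ) :
    Real.exp (-φ) / (1 - Real.exp (-φ)) ^ 2 = (Real.exp φ + Real.exp (-φ) - 2)⁻¹ := by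
  have hpos : 0 < Real.exp φ := Real.exp_pos φ
  have hE : Real.exp φ ≠ 0 := hpos.ne'
  rw [Real.exp_neg]
  have key1 : (1 - (Real.exp φ)⁻¹) ^ 2 = (Real.exp φ - 1) ^ 2 / Real.exp φ ^ 2 := by
    field_simp
  have key2 : Real.exp φ + (Real.exp φ)⁻¹ - 2 = (Real.exp φ - 1) ^ 2 / Real.exp φ := by
    field_simp
    ring
  rw [key1, key2, div_div_eq_mul_div, inv_div]
  congr 1
  rw [pow_two, ← mul_assoc, inv_mul_cancel₀ hE, one_mul]

/-- **`B(φ) ≤ 1/φ²`** for `φ > 0`. [folklore] -/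
theorem bose_kernel_le_inv_sq {φ : ℝ} (hφ : 0 < φ) :
    Real.exp (-φ) / (1 - Real.exp (-φ)) ^ 2 ≤ 1 / φ ^ 2 := by
  rw [bose_kernel_eq_inv, ← one_div]
  have h := sq_le_exp_add_exp_neg_sub_two hφ.le
  exact one_div_le_one_div_of_le (by positivity) h

/-- **`e^φ + e^{−φ} − 2 ≤ φ² + (5/48)φ⁴` for `0 ≤ φ ≤ 1`** (Taylor with remainder at order 4, `Real.exp_bound`). [folklore] -/
theorem exp_add_exp_neg_sub_two_le {φ : ℝ} (hφ0 : 0 ≤ φ) (hφ1 : φ ≤ 1) :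
    Real.exp φ + Real.exp (-φ) - 2 ≤ φ ^ 2 + 5 / 48 * φ ^ 4 := by
  have hT : ∀ x : ℝ, ∑ m ∈ range 4, x ^ m / (m.factorial : ℝ) = 1 + x + x ^ 2 / 2 + x ^ 3 / 6 := by
    intro x
    simp only [Finset.sum_range_succ, Finset.sum_range_zero, Nat.factorial]
    push_cast
    ring
  have h1 := Real.exp_bound (x := φ) (by rw [abs_of_nonneg hφ0]; exact hφ1) (n := 4) (by norm_num)
  have h2 := Real.exp_bound (x := -φ) (by rw [abs_neg, abs_of_nonneg hφ0]; exact hφ1) (n := 4) (by norm_num)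
  rw [hT, abs_of_nonneg hφ0] at h1
  rw [hT, abs_neg, abs_of_nonneg hφ0] at h2
  have hc : ((Nat.succ 4 : ℕ) : ℝ) / ((Nat.factorial 4 : ℕ) * (4 : ℕ)) = 5 / 96 := by norm_num [Nat.factorial]
  rw [hc] at h1 h2
  have e1 := (abs_le.1 h1).2
  have e2 := (abs_le.1 h2).2
  nlinarith

/-- **`|B(φ) − 1/φ²| ≤ 1` for every `φ > 0`** (`φ ≤ 1`: `B − 1/φ² ∈ [−5/48, 0]`; `φ ≥ 1`: `0 ≤ B ≤ 1/φ² ≤ 1`). [folklore] -/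
theorem abs_bose_kernel_sub_inv_sq_le {φ : ℝ} (hφ : 0 < φ) :
    |Real.exp (-φ) / (1 - Real.exp (-φ)) ^ 2 - 1 / φ ^ 2| ≤ 1 := by
  have hup := bose_kernel_le_inv_sq hφ
  have hB0 : 0 ≤ Real.exp (-φ) / (1 - Real.exp (-φ)) ^ 2 := by positivity
  rcases le_or_gt φ 1 with h1 | h1
  · -- `φ ≤ 1`
    set D := Real.exp φ + Real.exp (-φ) - 2 with hD
    have hDlo : φ ^ 2 ≤ D := sq_le_exp_add_exp_neg_sub_two hφ.le
    have hDhi : D ≤ φ ^ 2 + 5 / 48 * φ ^ 4 := exp_add_exp_neg_sub_two_le hφ.le h1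
    have hφ2 : 0 < φ ^ 2 := by positivity
    have hD0 : 0 < D := lt_of_lt_of_le hφ2 hDlo
    rw [bose_kernel_eq_inv, ← hD, abs_le, inv_eq_one_div]
    have hφ21 : φ ^ 2 ≤ 1 := by nlinarith
    have hφ4 : φ ^ 4 ≤ φ ^ 2 := by
      calc φ ^ 4 = φ ^ 2 * φ ^ 2 := by ring
        _ ≤ φ ^ 2 * 1 := mul_le_mul_of_nonneg_left hφ21 hφ2.le
        _ = φ ^ 2 := mul_one _
    have hup' : 1 / D ≤ 1 / φ ^ 2 := one_div_le_one_div_of_le hφ2 hDlo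
    constructor
    · -- `1/D − 1/φ² = (φ² − D)/(Dφ²) ≥ −1` since `D − φ² ≤ (5/48)φ⁴ ≤ φ⁴ ≤ Dφ²`
      have hx : D - φ ^ 2 ≤ D * φ ^ 2 := by nlinarith
      rw [div_sub_div _ _ hD0.ne' hφ2.ne', le_div_iff₀ (mul_pos hD0 hφ2)]
      nlinarith
    · linarith
  · -- `φ ≥ 1`
    have hle1 : 1 / φ ^ 2 ≤ 1 := by
      rw [div_le_one (by positivity)]; nlinarith
    rw [abs_le]
    constructor <;> linarith

end Summit.Parity.GeneralizedHardyLittlewood.Theorems.MomentsBeyondDiagonal.DiagLines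

end
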